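import Summits.HodgeConjecture.CorCM.HypLiu418.A3Liu418IsogenyDescent
import Summits.HodgeConjecture.CorCM.D2Bridge.ClosedPrintedMuKeyIdentLemD3DelRecConjOmegaT
import Literature.NumberTheory.Automorphic.Liu2021.AppendixC.RestOneLevelInvariantsHom
import Literature.AlgebraicGeometry.ShimuraVarieties.UnitaryShimuraLevelQuotientHolds
import Literature.NumberTheory.Automorphic.Liu2021.AppendixC.AlbaneseTraceOfFiniteQuotientOfCocycle
import HarnessLib

/-!
# [Liu2021, Thm. 4.18 (1)] item (1), descent half (D) at the pin: `stub_honestIsogenyDescent` of the line `a3-liu418` (v3),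
# CLOSED MODULO the two named facts `levelQuotient_printed` and `AlbaneseTraceOfFiniteQuotient`

THEOREMS ONLY (no definition, no named fact, no instance, no `sorry`).  Cell hodgecm-mathlib, fan A, rung A-III, KEY
`a3-honest-isogeny-descent` (seat B-p07; skeleton `A-plan/lines/a3-liu418.lean` v3 sha16 1b96ade3f8b6b529, stub :639, type
`StubHonestIsogenyDescent` :512 = `∀ hDel F [IsGalois ℚ F] h6 {ι₁} V Φ, (T_V …).IsogenyDescent`).  HC_CM is proved only modulo the 7 printed
citations until rung 0 closes.

`stubHonestIsogenyDescent_of (hQ : levelQuotient_printed) (hAT : AlbaneseTraceOfFiniteQuotient.{0}) : StubHonestIsogenyDescent`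
(statement unfolded VERBATIM, `TV` expanded as in A-p07's binder `hD` of `stubLevelInvariants_of_atrEpi_of_isogenyDescent`, p594701):
the instantiation of `Model.isogenyDescent_heckeTranslatesFamilyOf` (`HypLiu418/A3Liu418IsogenyDescent.lean`, p598007) at
`hU7 := heckeTranslate_definedOver_holds`, `h := DelRec.exists_recordSystem_of_printed hDel`, `iso := isoOf`.  The two hypotheses are the
NAMED FACTS (D-0014) `UnitaryCanonicalModel.levelQuotient_printed` ([Deligne1979ShimuraVarieties] 2.7.1 (c), `X_K = X_N/(K/N)`; A-p12 p597637)
and `Liu2021.AppendixC.AlbaneseTraceOfFiniteQuotient` ([Lang1983AbelianVarieties] VIII §6, the Albanese trace of a finite quotient; B-p07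
p596050); they are to be threaded into the head `HypLiu418_of` like `Thm415AtFace`.  Strategy token: «adjunction ∕ quotUP transport + Albanese
trace» (base change along `c` is a self-equivalence; `K/N` finite acts by `T_{k⁻¹}`; descent up to `[K:N]`).  Hence also the glued item (1):
`stubLevelInvariants_of_atrEpi hE hQ hAT` = A-p07's `stubLevelInvariants_of_atrEpi_of_isogenyDescent hE (stubHonestIsogenyDescent_of hQ hAT)`.
-/

set_option autoImplicit false

noncomputable section

namespace Summit.HodgeConjecture.CorCM.Lines.A3Liu418

open scoped TensorProduct Matrix
open NumberField NumberField.InfinitePlace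
open HodgeCM.Model HodgeCM.Model.LiuIndex HodgeCM.Model.TowerCarrier
open Summit.HodgeConjecture.CorCM.Model
open Literature.AlgebraicGeometry.Motives (CMType)
open Literature.AlgebraicGeometry.ShimuraVarieties.UnitaryCanonicalModel
open Literature.NumberTheory.Automorphic
open Literature.NumberTheory.Automorphic.Liu2021 Literature.NumberTheory.Automorphic.Liu2021.AppendixC
open Summit.HodgeConjecture.CorCM.Transposition

set_option synthInstance.maxHeartbeats 400000 in
set_option maxHeartbeats 8000000 in
/-- **(D) `StubHonestIsogenyDescent` of `a3-liu418` v3, modulo the two named facts** (statement = skeleton :512–:516 with `TV` unfolded, =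
A-p07's binder `hD`): for every hDel datum at a face (`6 ≤ [F:ℚ]`), the Albanese Hecke translates `T_V` of `V`'s own §4.2 datum satisfy
`HeckeTranslates.IsogenyDescent` — granted `levelQuotient_printed` ([Deligne1979ShimuraVarieties] 2.7.1 (c)) and
`AlbaneseTraceOfFiniteQuotient` ([Lang1983AbelianVarieties] VIII §6). [cite: Liu2021, Thm. 4.18 (1) FJcycle.tex l. 2239 and l. 2274–2282; Lem. 2.4 (1); Rem. 4.17] -/
theorem stubHonestIsogenyDescent_of (hQ : levelQuotient_printed) (hAT : AlbaneseTraceOfFiniteQuotient.{0}) :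
  ∀ (hDel : Literature.AlgebraicGeometry.ShimuraVarieties.UnitaryCanonicalModel.canonicalModel_exists_printed)
      (F : HodgeCM.CMField) [IsGalois ℚ F] (h6 : 6 ≤ Module.finrank ℚ F) {ι₁ : F →+* ℂ} (V : HodgeCM.HermSpace3 F ι₁) (Φ : CMType F),
      (heckeTranslatesFamilyOf heckeTranslate_definedOver_holds (Summit.HodgeConjecture.CorCM.DelRec.exists_recordSystem_of_printed hDel) isoOf ⟨HodgeCM.CMField.K F⟩ ι₁ ⟨HodgeCM.HermSpace3.Hm V, HodgeCM.HermSpace3.isHermitian V, HodgeCM.HermSpace3.signature_ι₁ V, HodgeCM.HermSpace3.posDef_of_ne V⟩ Φ h6).IsogenyDescent := by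
  intro hDel F _ h6 ι₁ V Φ
  exact isogenyDescent_heckeTranslatesFamilyOf hQ hAT heckeTranslate_definedOver_holds
    (Summit.HodgeConjecture.CorCM.DelRec.exists_recordSystem_of_printed hDel) isoOf _ Φ h6

set_option synthInstance.maxHeartbeats 400000 in
set_option maxHeartbeats 8000000 in
/-- **(D) `StubHonestIsogenyDescent` modulo `AlbaneseTraceOfFiniteQuotient` ONLY**: the hypothesis `levelQuotient_printed`
([Deligne1979ShimuraVarieties] 2.7.1 (c), `M_K = M_N/(K/N)`) of `stubHonestIsogenyDescent_of` is now a THEOREM of the tree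
(`UnitaryCanonicalModel.levelQuotient_printed_holds`, `ShimuraVarieties/UnitaryShimuraLevelQuotientHolds.lean`, row VI-6), so the
stub is conditional on the single named fact (T) = `AlbaneseTraceOfFiniteQuotient` ([Lang1983AbelianVarieties] VIII §6 Thm. 13).
Slot: `theorem stub_honestIsogenyDescent : StubHonestIsogenyDescent := stubHonestIsogenyDescent_of_albaneseTrace hAT`.
[cite: Liu2021, Thm. 4.18 (1) FJcycle.tex l. 2239 and l. 2274–2282; Lem. 2.4 (1); Rem. 4.17] -/
theorem stubHonestIsogenyDescent_of_albaneseTrace (hAT : AlbaneseTraceOfFiniteQuotient.{0}) :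
  ∀ (hDel : Literature.AlgebraicGeometry.ShimuraVarieties.UnitaryCanonicalModel.canonicalModel_exists_printed)
      (F : HodgeCM.CMField) [IsGalois ℚ F] (h6 : 6 ≤ Module.finrank ℚ F) {ι₁ : F →+* ℂ} (V : HodgeCM.HermSpace3 F ι₁) (Φ : CMType F),
      (heckeTranslatesFamilyOf heckeTranslate_definedOver_holds (Summit.HodgeConjecture.CorCM.DelRec.exists_recordSystem_of_printed hDel) isoOf ⟨HodgeCM.CMField.K F⟩ ι₁ ⟨HodgeCM.HermSpace3.Hm V, HodgeCM.HermSpace3.isHermitian V, HodgeCM.HermSpace3.signature_ι₁ V, HodgeCM.HermSpace3.posDef_of_ne V⟩ Φ h6).IsogenyDescent :=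
  stubHonestIsogenyDescent_of levelQuotient_printed_holds hAT

open CategoryTheory

set_option synthInstance.maxHeartbeats 400000 in
set_option maxHeartbeats 8000000 in
/-- **(D) `StubHonestIsogenyDescent` from the Albanese trace IN THE CURRENCY `k ⊂ ℂ`** (re-threading, row VI-5): the same conclusion
as `stubHonestIsogenyDescent_of_albaneseTrace`, but the hypothesis is the Albanese trace of a finite quotient for fields `k : Type`
CARRYING AN EMBEDDING INTO `ℂ` (`[Algebra k ℂ]`) — the shape in which (T) is PROVED by the cocycle ∕ `∇`-descent chain
(`AppendixC/AlbaneseCocycle.lean`, `AlbaneseTraceExtension.lean`, `Motives/FiniteQuotientProductDescent.lean`; B-p16's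
`Albanese.exists_trace_of_isSepQuotient_complex`) — instead of the named fact `AlbaneseTraceOfFiniteQuotient.{0}` over ALL fields of
characteristic zero.  At the face the CM field `F` is embedded by `ι₁` (`ι₁.toAlgebra`); `levelQuotient_printed` enters PROVED
(`levelQuotient_printed_holds`).  So the stub closes BY NAME the moment the `[Algebra k ℂ]`-trace lands, whichever way the typed fact is
ruled.  HC_CM is proved only modulo the 7 printed citations until rung 0 closes.
[cite: Liu2021, Thm. 4.18 (1) FJcycle.tex l. 2239 and l. 2274–2282; Lem. 2.4 (1); Rem. 4.17] [cite: Lang1983AbelianVarieties, Ch. VIII §6 Thm. 13, pp. 224–227] -/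
theorem stubHonestIsogenyDescent_of_complexTrace
    (hATc : ∀ (k : Type) [Field k] [CharZero k] [Algebra k ℂ] (X Y : Literature.AlgebraicGeometry.Motives.SchemeOver k) (dX dY : ℕ)
      [AlgebraicGeometry.SmoothOfRelativeDimension dX X.hom] [AlgebraicGeometry.SmoothOfRelativeDimension dY Y.hom],
      Literature.AlgebraicGeometry.Motives.IsProjectiveOver X → Literature.AlgebraicGeometry.Motives.IsProjectiveOver Y →
      ∀ (Δ : Type) [Group Δ] [Fintype Δ] (act : Δ →* CategoryTheory.Aut X) (p : X ⟶ Y),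
        Literature.AlgebraicGeometry.Motives.IsSepQuotient (fun g => act g) p →
        ∀ (aX : Albanese X) (aY : Albanese Y),
          ∃ t : aY.Alb ⟶ aX.Alb, aX.map aY p ≫ t = Finset.univ.sum fun g : Δ => aX.map aX (act g).hom) :
  ∀ (hDel : Literature.AlgebraicGeometry.ShimuraVarieties.UnitaryCanonicalModel.canonicalModel_exists_printed)
      (F : HodgeCM.CMField) [IsGalois ℚ F] (h6 : 6 ≤ Module.finrank ℚ F) {ι₁ : F →+* ℂ} (V : HodgeCM.HermSpace3 F ι₁) (Φ : CMType F),
      (heckeTranslatesFamilyOf heckeTranslate_definedOver_holds (Summit.HodgeConjecture.CorCM.DelRec.exists_recordSystem_of_printed hDel) isoOf ⟨HodgeCM.CMField.K F⟩ ι₁ ⟨HodgeCM.HermSpace3.Hm V, HodgeCM.HermSpace3.isHermitian V, HodgeCM.HermSpace3.signature_ι₁ V, HodgeCM.HermSpace3.posDef_of_ne V⟩ Φ h6).IsogenyDescent := by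
  intro hDel F _ h6 ι₁ V Φ
  letI : Algebra (HodgeCM.CMField.K F) ℂ := ι₁.toAlgebra
  exact isogenyDescent_heckeTranslatesFamilyOf_of_trace levelQuotient_printed_holds
    (fun X Y dX dY _ _ hX hY Δ _ _ act p hp aX aY => hATc _ X Y dX dY hX hY Δ act p hp aX aY)
    heckeTranslate_definedOver_holds (Summit.HodgeConjecture.CorCM.DelRec.exists_recordSystem_of_printed hDel) isoOf _ Φ h6

set_option synthInstance.maxHeartbeats 400000 in
set_option maxHeartbeats 8000000 in
/-- **(D) `StubHonestIsogenyDescent` UNCONDITIONALLY** (row VI-4 `HonestIsogenyDescent` of the cell INVENTORY, = A-p07's binder `hD`,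
= the statement of `stubHonestIsogenyDescent_of` with BOTH named facts discharged): `levelQuotient_printed` by
`levelQuotient_printed_holds` (row VI-6) and the Albanese trace of a finite quotient by the PROVED `[Algebra k ℂ]`-currency theorem
`Albanese.exists_trace_of_isSepQuotient_complex` (row VI-5: flatness of the quotient, cocycle and transitivity of `α_X`/`∇X` over
`k ⊂ ℂ`, extension over the translates, descent along `p × p`), read at the face through `ι₁ : F →+* ℂ`.  Slot:
`theorem stub_honestIsogenyDescent : StubHonestIsogenyDescent := stubHonestIsogenyDescent_holds`.  With `stubAlbTransitionEpi_holds`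
(row VI-3) item (1) of [Liu2021, Thm. 4.18] for the honest tower is now a THEOREM modulo `hDel` only.  HC_CM is proved only modulo the 7
printed citations until rung 0 closes. [cite: Liu2021, Thm. 4.18 (1) FJcycle.tex l. 2239 and l. 2274–2282; Lem. 2.4 (1); Rem. 4.17]
[cite: Lang1983AbelianVarieties, Ch. VIII §6 Thm. 13, pp. 224–227] [cite: Deligne1979ShimuraVarieties, 2.7.1 (c)] -/
theorem stubHonestIsogenyDescent_holds :
  ∀ (hDel : Literature.AlgebraicGeometry.ShimuraVarieties.UnitaryCanonicalModel.canonicalModel_exists_printed)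
      (F : HodgeCM.CMField) [IsGalois ℚ F] (h6 : 6 ≤ Module.finrank ℚ F) {ι₁ : F →+* ℂ} (V : HodgeCM.HermSpace3 F ι₁) (Φ : CMType F),
      (heckeTranslatesFamilyOf heckeTranslate_definedOver_holds (Summit.HodgeConjecture.CorCM.DelRec.exists_recordSystem_of_printed hDel) isoOf ⟨HodgeCM.CMField.K F⟩ ι₁ ⟨HodgeCM.HermSpace3.Hm V, HodgeCM.HermSpace3.isHermitian V, HodgeCM.HermSpace3.signature_ι₁ V, HodgeCM.HermSpace3.posDef_of_ne V⟩ Φ h6).IsogenyDescent :=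
  stubHonestIsogenyDescent_of_complexTrace fun _ _ _ _ _ _ dX dY _ _ hX hY _ _ _ act p hp aX aY =>
    Albanese.exists_trace_of_isSepQuotient_complex (dX := dX) (dY := dY) hX hY act p hp aX aY

end Summit.HodgeConjecture.CorCM.Lines.A3Liu418

end
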